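import Mathlib

/-!
# Route PhotonSphereChannels · BlindnessInsidePhotonSphere — the 1+1 wave equation with a
# potential, I: Picard's fixed point in null coordinates

Support file (pure analysis, everything proved) for item stmt-FinalStateConjecture-10049
(`BlindnessInsidePhotonSphere`). The Regge–Wheeler equation `ψ_tt − ψ_xx + V(x) ψ = 0` on the
tortoise line is, in null coordinates `a = x + t`, `b = x − t`, the equation
`Ψ_ab = c(a, b) Ψ` with `c(a, b) = V((a+b)/2)/4`, and Cauchy data `(A, 0)` on `{t = 0}` become
`Ψ(a, a) = A(a)`, `Ψ_a = Ψ_b = A'/2` on the diagonal. Writing `Q = Ψ_b`, the Cauchy problem is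
equivalent to the pair of Volterra integral equations

  `Ψ(a, b) = A(a) − ∫_b^a Q(a, s) ds`,   `Q(a, b) = A'(b)/2 + ∫_b^a c(s, b) Ψ(s, b) ds`,

(Courant–Hilbert, *Methods of Mathematical Physics II*, Ch. V §5; Garabedian, *Partial
Differential Equations*, §4.2 — Picard iteration for the characteristic initial value problem).
This file solves the pair by Banach's fixed point theorem on bounded continuous functions of
`(a, b) ∈ ℝ²` with the weight `e^{−L|a−b|}` (a Volterra operator is a contraction for `L` large),
for continuous bounded `c`, `A`, `A'`, and records that the solution vanishes on any set `Z` of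
the shape of the complement of a characteristic domain of influence
(`exists_picard_fixedPoint`). Regularity and the return to `(t, x)` are in the sequel file.
No definitions are introduced.
-/

noncomputable section

open Set Filter MeasureTheory intervalIntegral Topology Function
open scoped NNReal BoundedContinuousFunction Interval

namespace Summit.FinalStateConjecture.FinalStateConjecture.Theorems.Blindness

/-! ### The exponential weight `e^{L|a−b|}` integrates with a gain `1/L` -/

/-- `∫_b^a e^{L(a−s)} ds ≤ e^{L(a−b)}/L` for `L > 0` (any `a, b`). -/
theorem integral_exp_mul_sub_left_le {L : ℝ} (hL : 0 < L) (a b : ℝ) :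
    ∫ s in b..a, Real.exp (L * (a - s)) ≤ Real.exp (L * (a - b)) / L := by
  have hderiv : ∀ s ∈ uIcc b a,
      HasDerivAt (fun s => -Real.exp (L * (a - s)) / L) (Real.exp (L * (a - s))) s := by
    intro s _
    have h1 : HasDerivAt (fun s => L * (a - s)) (-L) s := by
      simpa using ((hasDerivAt_id s).const_sub a).const_mul L
    refine ((h1.exp.neg).div_const L).congr_deriv ?_
    rw [mul_neg, neg_neg, mul_div_cancel_right₀ _ hL.ne']
  have hint : IntervalIntegrable (fun s => Real.exp (L * (a - s))) volume b a :=
    (by fun_prop : Continuous fun s => Real.exp (L * (a - s))).intervalIntegrable _ _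
  rw [integral_eq_sub_of_hasDerivAt hderiv hint]
  have h0 : 0 < Real.exp (L * (a - a)) := Real.exp_pos _
  rw [show -Real.exp (L * (a - a)) / L - -Real.exp (L * (a - b)) / L
      = Real.exp (L * (a - b)) / L - Real.exp (L * (a - a)) / L by ring]
  linarith [div_pos h0 hL]

/-- `∫_a^b e^{L(s−a)} ds ≤ e^{L(b−a)}/L` for `L > 0` (any `a, b`). -/
theorem integral_exp_mul_sub_right_le {L : ℝ} (hL : 0 < L) (a b : ℝ) :
    ∫ s in a..b, Real.exp (L * (s - a)) ≤ Real.exp (L * (b - a)) / L := by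
  have hderiv : ∀ s ∈ uIcc a b,
      HasDerivAt (fun s => Real.exp (L * (s - a)) / L) (Real.exp (L * (s - a))) s := by
    intro s _
    have h1 : HasDerivAt (fun s => L * (s - a)) L s := by
      simpa using ((hasDerivAt_id s).sub_const a).const_mul L
    refine ((h1.exp).div_const L).congr_deriv ?_
    rw [mul_div_cancel_right₀ _ hL.ne']
  have hint : IntervalIntegrable (fun s => Real.exp (L * (s - a))) volume a b :=
    (by fun_prop : Continuous fun s => Real.exp (L * (s - a))).intervalIntegrable _ _
  rw [integral_eq_sub_of_hasDerivAt hderiv hint]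
  have h0 : 0 < Real.exp (L * (a - a)) := Real.exp_pos _
  rw [show Real.exp (L * (b - a)) / L - Real.exp (L * (a - a)) / L
      = Real.exp (L * (b - a)) / L - Real.exp (L * (a - a)) / L by rfl]
  linarith [div_pos h0 hL]

/-- `|∫_b^a e^{L|a−s|} ds| ≤ e^{L|a−b|}/L` (both orientations). -/
theorem abs_integral_exp_weight_fst_le {L : ℝ} (hL : 0 < L) (a b : ℝ) :
    |∫ s in b..a, Real.exp (L * |a - s|)| ≤ Real.exp (L * |a - b|) / L := by
  rcases le_total b a with hba | hab
  · have heq : ∫ s in b..a, Real.exp (L * |a - s|) = ∫ s in b..a, Real.exp (L * (a - s)) := by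
      refine integral_congr fun s hs => ?_
      rw [uIcc_of_le hba] at hs
      simp [abs_of_nonneg (sub_nonneg.2 hs.2)]
    rw [heq, abs_of_nonneg (sub_nonneg.2 hba),
      abs_of_nonneg (integral_nonneg hba fun s _ => (Real.exp_pos _).le)]
    exact integral_exp_mul_sub_left_le hL a b
  · have heq : ∫ s in b..a, Real.exp (L * |a - s|) = -∫ s in a..b, Real.exp (L * (s - a)) := by
      rw [integral_symm]
      refine congrArg Neg.neg (integral_congr fun s hs => ?_)
      rw [uIcc_of_le hab] at hs
      simp [abs_of_nonpos (sub_nonpos.2 hs.1)]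
    rw [heq, abs_neg, abs_of_nonpos (sub_nonpos.2 hab), neg_sub,
      abs_of_nonneg (integral_nonneg hab fun s _ => (Real.exp_pos _).le)]
    exact integral_exp_mul_sub_right_le hL a b

/-- `|∫_b^a e^{L|s−b|} ds| ≤ e^{L|a−b|}/L` (both orientations). -/
theorem abs_integral_exp_weight_snd_le {L : ℝ} (hL : 0 < L) (a b : ℝ) :
    |∫ s in b..a, Real.exp (L * |s - b|)| ≤ Real.exp (L * |a - b|) / L := by
  rcases le_total b a with hba | hab
  · have heq : ∫ s in b..a, Real.exp (L * |s - b|) = ∫ s in b..a, Real.exp (L * (s - b)) := by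
      refine integral_congr fun s hs => ?_
      rw [uIcc_of_le hba] at hs
      simp [abs_of_nonneg (sub_nonneg.2 hs.1)]
    rw [heq, abs_of_nonneg (sub_nonneg.2 hba),
      abs_of_nonneg (integral_nonneg hba fun s _ => (Real.exp_pos _).le)]
    exact integral_exp_mul_sub_right_le hL b a
  · have heq : ∫ s in b..a, Real.exp (L * |s - b|) = -∫ s in a..b, Real.exp (L * (b - s)) := by
      rw [integral_symm]
      refine congrArg Neg.neg (integral_congr fun s hs => ?_)
      rw [uIcc_of_le hab] at hs
      simp [abs_of_nonpos (sub_nonpos.2 hs.2)]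
    rw [heq, abs_neg, abs_of_nonpos (sub_nonpos.2 hab), neg_sub,
      abs_of_nonneg (integral_nonneg hab fun s _ => (Real.exp_pos _).le)]
    exact integral_exp_mul_sub_left_le hL b a

/-- The Volterra gain: if `|f s| ≤ N w(s)` along the segment with `w` one of the two weights,
`|∫_b^a f| ≤ N e^{L|a−b|}/L`. Abstract form with the weight integral bound as a hypothesis. -/
theorem abs_integral_le_of_weight {f w : ℝ → ℝ} {N B : ℝ} {a b : ℝ} (hN : 0 ≤ N)
    (hf : IntervalIntegrable f volume b a) (hw : Continuous w) (hw0 : ∀ s, 0 ≤ w s)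
    (hfw : ∀ s ∈ Ι b a, |f s| ≤ N * w s) (hB : |∫ s in b..a, w s| ≤ B) :
    |∫ s in b..a, f s| ≤ N * B := by
  have h1 : |∫ s in b..a, f s| ≤ ∫ s in Ι b a, |f s| := by
    simpa only [Real.norm_eq_abs] using norm_integral_le_integral_norm_uIoc (f := f) (μ := volume)
      (a := b) (b := a)
  have h2 : ∫ s in Ι b a, |f s| ≤ ∫ s in Ι b a, N * w s := by
    refine setIntegral_mono_on ?_ ?_ measurableSet_uIoc hfw
    · exact hf.def'.norm
    · exact ((hw.const_mul N).intervalIntegrable b a).def'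
  have h3 : ∫ s in Ι b a, N * w s = N * |∫ s in b..a, w s| := by
    have hnn : 0 ≤ ∫ s in Ι b a, w s :=
      setIntegral_nonneg measurableSet_uIoc fun s _ => hw0 s
    have : |∫ s in b..a, w s| = ∫ s in Ι b a, w s := by
      rw [← Real.norm_eq_abs, norm_integral_eq_norm_integral_uIoc, Real.norm_eq_abs,
        abs_of_nonneg hnn]
    rw [this, MeasureTheory.integral_const_mul]
  calc |∫ s in b..a, f s| ≤ ∫ s in Ι b a, N * w s := h1.trans h2
    _ = N * |∫ s in b..a, w s| := h3
    _ ≤ N * B := mul_le_mul_of_nonneg_left hB hN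

/-- Interval integrals with both endpoints depending continuously on a parameter are continuous
(from Mathlib's `continuous_parametric_intervalIntegral_of_continuous`). -/
theorem continuous_intervalIntegral_param {X : Type*} [TopologicalSpace X] {f : X → ℝ → ℝ}
    (hf : Continuous (uncurry f)) {u v : X → ℝ} (hu : Continuous u) (hv : Continuous v) :
    Continuous fun x => ∫ s in u x..v x, f x s := by
  have heq : (fun x => ∫ s in u x..v x, f x s)
      = fun x => (∫ s in (0:ℝ)..v x, f x s) - ∫ s in (0:ℝ)..u x, f x s := by
    funext x
    have hx : Continuous (f x) := hf.comp (Continuous.prodMk_right x)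
    rw [integral_interval_sub_left (hx.intervalIntegrable _ _) (hx.intervalIntegrable _ _)]
  rw [heq]
  exact (continuous_parametric_intervalIntegral_of_continuous hf hv).sub
    (continuous_parametric_intervalIntegral_of_continuous hf hu)

/-! ### Picard's fixed point for the characteristic integral equations -/

/-- **Existence for the characteristic integral equations.** For continuous bounded `c` on `ℝ²`
and continuous bounded `A`, `A'` there are continuous `Ψ, Q : ℝ² → ℝ` with
`Ψ(a,b) = A(a) − ∫_b^a Q(a,s) ds` and `Q(a,b) = A'(b)/2 + ∫_b^a c(s,b) Ψ(s,b) ds` for all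
`(a, b)`; moreover `Ψ = Q = 0` on any set `Z` on which `A(a) = A'(b) = 0` and which contains,
with `(a, b)`, the two characteristic segments `{a} × [a, b]`, `[a, b] × {b}` (Banach's fixed point
theorem for the weight `e^{−L|a−b|}`, `L = 2 max(1, C)`; the closed set of pairs vanishing on `Z`
is invariant). -/
theorem exists_picard_fixedPoint {c : ℝ → ℝ → ℝ} {A A' : ℝ → ℝ} {C MA MA' : ℝ}
    (hc : Continuous (uncurry c)) (hcb : ∀ a b, |c a b| ≤ C)
    (hA : Continuous A) (hA' : Continuous A') (hAb : ∀ a, |A a| ≤ MA) (hA'b : ∀ b, |A' b| ≤ MA')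
    (Z : Set (ℝ × ℝ)) (hZA : ∀ p ∈ Z, A p.1 = 0) (hZA' : ∀ p ∈ Z, A' p.2 = 0)
    (hZ1 : ∀ p ∈ Z, ∀ s ∈ uIcc p.2 p.1, (p.1, s) ∈ Z)
    (hZ2 : ∀ p ∈ Z, ∀ s ∈ uIcc p.2 p.1, (s, p.2) ∈ Z) :
    ∃ Ψ Q : ℝ → ℝ → ℝ, Continuous (uncurry Ψ) ∧ Continuous (uncurry Q) ∧
      (∀ a b, Ψ a b = A a - ∫ s in b..a, Q a s) ∧
      (∀ a b, Q a b = A' b / 2 + ∫ s in b..a, c s b * Ψ s b) ∧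
      (∀ p ∈ Z, Ψ p.1 p.2 = 0 ∧ Q p.1 p.2 = 0) := by
  -- the weight and its constant
  set L : ℝ := 2 * max 1 C with hL
  have hL0 : 0 < L := by positivity
  have hCL : C ≤ L / 2 := by rw [hL]; linarith [le_max_right 1 C]
  have h1L : 1 ≤ L / 2 := by rw [hL]; linarith [le_max_left 1 C]
  have hC0 : 0 ≤ C := (abs_nonneg _).trans (hcb 0 0)
  have hMA : 0 ≤ MA := (abs_nonneg _).trans (hAb 0)
  have hMA' : 0 ≤ MA' := (abs_nonneg _).trans (hA'b 0)
  set w : ℝ → ℝ → ℝ := fun a b => Real.exp (L * |a - b|) with hw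
  have hwpos : ∀ a b, 0 < w a b := fun a b => Real.exp_pos _
  have hwcont : Continuous (uncurry w) := by
    show Continuous fun p : ℝ × ℝ => Real.exp (L * |p.1 - p.2|)
    fun_prop
  have hw1 : ∀ a b, 1 ≤ w a b := fun a b => Real.one_le_exp (by positivity)
  -- the (weighted) Picard operator as a map on functions
  set T : (ℝ × ℝ →ᵇ ℝ × ℝ) → ℝ × ℝ → ℝ × ℝ := fun g p =>
    ((w p.1 p.2)⁻¹ * (A p.1 - ∫ s in p.2..p.1, (g (p.1, s)).2 * w p.1 s),
     (w p.1 p.2)⁻¹ * (A' p.2 / 2 + ∫ s in p.2..p.1, c s p.2 * ((g (s, p.2)).1 * w s p.2)))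
    with hT
  -- continuity of `T g`
  have hTcont : ∀ g : ℝ × ℝ →ᵇ ℝ × ℝ, Continuous (T g) := by
    intro g
    have hg : Continuous (g : ℝ × ℝ → ℝ × ℝ) := g.continuous
    have hwinv : Continuous fun p : ℝ × ℝ => (w p.1 p.2)⁻¹ :=
      hwcont.inv₀ fun p => (hwpos p.1 p.2).ne'
    refine Continuous.prodMk (hwinv.mul ((hA.comp continuous_fst).sub ?_))
      (hwinv.mul (((hA'.comp continuous_snd).div_const 2).add ?_))
    · refine continuous_intervalIntegral_param (f := fun p s => (g (p.1, s)).2 * w p.1 s) ?_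
        continuous_snd continuous_fst
      exact (continuous_snd.comp (hg.comp (continuous_fst.fst'.prodMk continuous_snd))).mul
        (hwcont.comp (continuous_fst.fst'.prodMk continuous_snd))
    · refine continuous_intervalIntegral_param
        (f := fun p s => c s p.2 * ((g (s, p.2)).1 * w s p.2)) ?_ continuous_snd continuous_fst
      exact (hc.comp (continuous_snd.prodMk continuous_fst.snd)).mul
        ((continuous_fst.comp (hg.comp (continuous_snd.prodMk continuous_fst.snd))).mul
          (hwcont.comp (continuous_snd.prodMk continuous_fst.snd)))
  -- the two Volterra estimates
  have hV1 : ∀ (g : ℝ × ℝ →ᵇ ℝ × ℝ) (a b : ℝ),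
      |∫ s in b..a, (g (a, s)).2 * w a s| ≤ ‖g‖ * (w a b / L) := by
    intro g a b
    refine abs_integral_le_of_weight (norm_nonneg g) ?_ ?_ (fun s => (hwpos a s).le) ?_
      (abs_integral_exp_weight_fst_le hL0 a b)
    · exact ((continuous_snd.comp (g.continuous.comp (Continuous.prodMk_right a))).mul
        (hwcont.comp (Continuous.prodMk_right a))).intervalIntegrable _ _
    · exact hwcont.comp (Continuous.prodMk_right a)
    · intro s _
      rw [abs_mul, abs_of_pos (hwpos a s)]
      refine mul_le_mul_of_nonneg_right ?_ (hwpos a s).le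
      calc |(g (a, s)).2| = ‖(g (a, s)).2‖ := (Real.norm_eq_abs _).symm
        _ ≤ ‖g (a, s)‖ := norm_snd_le _
        _ ≤ ‖g‖ := g.norm_coe_le_norm _
  have hV2 : ∀ (g : ℝ × ℝ →ᵇ ℝ × ℝ) (a b : ℝ),
      |∫ s in b..a, c s b * ((g (s, b)).1 * w s b)| ≤ (C * ‖g‖) * (w a b / L) := by
    intro g a b
    refine abs_integral_le_of_weight (mul_nonneg hC0 (norm_nonneg g)) ?_ ?_
      (fun s => (hwpos s b).le) ?_ (abs_integral_exp_weight_snd_le hL0 a b)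
    · exact ((hc.comp (continuous_id.prodMk continuous_const)).mul
        ((continuous_fst.comp (g.continuous.comp (continuous_id.prodMk continuous_const))).mul
          (hwcont.comp (continuous_id.prodMk continuous_const)))).intervalIntegrable _ _
    · exact hwcont.comp (continuous_id.prodMk continuous_const)
    · intro s _
      rw [abs_mul, abs_mul, abs_of_pos (hwpos s b), ← mul_assoc]
      refine mul_le_mul_of_nonneg_right (mul_le_mul (hcb s b) ?_ (abs_nonneg _) hC0)
        (hwpos s b).le
      calc |(g (s, b)).1| = ‖(g (s, b)).1‖ := (Real.norm_eq_abs _).symm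
        _ ≤ ‖g (s, b)‖ := norm_fst_le _
        _ ≤ ‖g‖ := g.norm_coe_le_norm _
  -- boundedness of `T g`
  have hTbd : ∀ (g : ℝ × ℝ →ᵇ ℝ × ℝ) (p : ℝ × ℝ),
      ‖T g p‖ ≤ max (MA + ‖g‖ / L) (MA' / 2 + C * ‖g‖ / L) := by
    intro g p
    have hwi : 0 < (w p.1 p.2)⁻¹ := inv_pos.2 (hwpos _ _)
    have hwi1 : (w p.1 p.2)⁻¹ ≤ 1 := inv_le_one_of_one_le₀ (hw1 _ _)
    rw [Prod.norm_def]
    refine max_le_max ?_ ?_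
    · rw [hT]; dsimp only
      rw [Real.norm_eq_abs, abs_mul, abs_of_pos hwi]
      have h1 := hV1 g p.1 p.2
      have h2 := hAb p.1
      calc (w p.1 p.2)⁻¹ * |A p.1 - ∫ s in p.2..p.1, (g (p.1, s)).2 * w p.1 s|
          ≤ (w p.1 p.2)⁻¹ * (|A p.1| + |∫ s in p.2..p.1, (g (p.1, s)).2 * w p.1 s|) :=
            mul_le_mul_of_nonneg_left (abs_sub _ _) hwi.le
        _ ≤ (w p.1 p.2)⁻¹ * |A p.1| + (w p.1 p.2)⁻¹ * (‖g‖ * (w p.1 p.2 / L)) := by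
            rw [mul_add]; gcongr
        _ ≤ 1 * MA + ‖g‖ / L := by
            gcongr
            rw [← mul_assoc, mul_div_assoc', mul_comm (w p.1 p.2)⁻¹,
              mul_assoc, inv_mul_cancel₀ (hwpos _ _).ne', mul_one]
        _ = MA + ‖g‖ / L := by ring
    · rw [hT]; dsimp only
      rw [Real.norm_eq_abs, abs_mul, abs_of_pos hwi]
      have h1 := hV2 g p.1 p.2
      have h2 := hA'b p.2
      calc (w p.1 p.2)⁻¹ * |A' p.2 / 2 + ∫ s in p.2..p.1, c s p.2 * ((g (s, p.2)).1 * w s p.2)|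
          ≤ (w p.1 p.2)⁻¹ * (|A' p.2 / 2|
              + |∫ s in p.2..p.1, c s p.2 * ((g (s, p.2)).1 * w s p.2)|) :=
            mul_le_mul_of_nonneg_left (abs_add_le _ _) hwi.le
        _ ≤ (w p.1 p.2)⁻¹ * |A' p.2 / 2| + (w p.1 p.2)⁻¹ * ((C * ‖g‖) * (w p.1 p.2 / L)) := by
            rw [mul_add]; gcongr
        _ ≤ 1 * (MA' / 2) + C * ‖g‖ / L := by
            gcongr
            · rw [abs_div, abs_two]; exact div_le_div_of_nonneg_right h2 zero_le_two
            · rw [← mul_assoc, mul_div_assoc', mul_comm (w p.1 p.2)⁻¹,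
                mul_assoc, inv_mul_cancel₀ (hwpos _ _).ne', mul_one]
        _ = MA' / 2 + C * ‖g‖ / L := by ring
  -- the operator on bounded continuous functions
  set Φ : (ℝ × ℝ →ᵇ ℝ × ℝ) → (ℝ × ℝ →ᵇ ℝ × ℝ) := fun g =>
    BoundedContinuousFunction.ofNormedAddCommGroup (T g) (hTcont g) _ (hTbd g) with hΦ
  have hΦapply : ∀ g p, Φ g p = T g p := fun g p => rfl
  -- contraction
  have hLip : ∀ g g' : ℝ × ℝ →ᵇ ℝ × ℝ, dist (Φ g) (Φ g') ≤ (1 / 2 : ℝ) * dist g g' := by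
    intro g g'
    refine (BoundedContinuousFunction.dist_le (by positivity)).2 fun p => ?_
    rw [hΦapply, hΦapply, Prod.dist_eq]
    have hwi : 0 < (w p.1 p.2)⁻¹ := inv_pos.2 (hwpos _ _)
    have hdist : dist g g' = ‖g - g'‖ := dist_eq_norm _ _
    refine max_le ?_ ?_
    · rw [hT]; dsimp only
      rw [Real.dist_eq, ← mul_sub, abs_mul, abs_of_pos hwi, sub_sub_sub_cancel_left]
      have hint : ∀ h : ℝ × ℝ →ᵇ ℝ × ℝ,
          IntervalIntegrable (fun s => (h (p.1, s)).2 * w p.1 s) volume p.2 p.1 := fun h =>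
        ((continuous_snd.comp (h.continuous.comp (Continuous.prodMk_right p.1))).mul
          (hwcont.comp (Continuous.prodMk_right p.1))).intervalIntegrable _ _
      rw [← integral_sub (hint g') (hint g)]
      have h1 := hV1 (g' - g) p.1 p.2
      have heq : (fun s => (g' (p.1, s)).2 * w p.1 s - (g (p.1, s)).2 * w p.1 s)
          = fun s => ((g' - g) (p.1, s)).2 * w p.1 s := by
        funext s; simp [sub_mul]
      rw [heq]
      calc (w p.1 p.2)⁻¹ * |∫ s in p.2..p.1, ((g' - g) (p.1, s)).2 * w p.1 s|
          ≤ (w p.1 p.2)⁻¹ * (‖g' - g‖ * (w p.1 p.2 / L)) :=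
            mul_le_mul_of_nonneg_left h1 hwi.le
        _ = ‖g' - g‖ / L := by
            rw [← mul_assoc, mul_div_assoc', mul_comm (w p.1 p.2)⁻¹, mul_assoc,
              inv_mul_cancel₀ (hwpos _ _).ne', mul_one]
        _ ≤ 1 / 2 * dist g g' := by
            rw [hdist, norm_sub_rev, div_le_iff₀ hL0]
            nlinarith [norm_nonneg (g - g')]
    · rw [hT]; dsimp only
      rw [Real.dist_eq, ← mul_sub, abs_mul, abs_of_pos hwi, add_sub_add_left_eq_sub]
      have hint : ∀ h : ℝ × ℝ →ᵇ ℝ × ℝ, IntervalIntegrable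
          (fun s => c s p.2 * ((h (s, p.2)).1 * w s p.2)) volume p.2 p.1 := fun h =>
        ((hc.comp (continuous_id.prodMk continuous_const)).mul
          ((continuous_fst.comp (h.continuous.comp (continuous_id.prodMk continuous_const))).mul
            (hwcont.comp (continuous_id.prodMk continuous_const)))).intervalIntegrable _ _
      rw [← integral_sub (hint g) (hint g')]
      have h1 := hV2 (g - g') p.1 p.2
      have heq : (fun s => c s p.2 * ((g (s, p.2)).1 * w s p.2)
            - c s p.2 * ((g' (s, p.2)).1 * w s p.2))
          = fun s => c s p.2 * (((g - g') (s, p.2)).1 * w s p.2) := by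
        funext s; simp [sub_mul, mul_sub]
      rw [heq]
      calc (w p.1 p.2)⁻¹ * |∫ s in p.2..p.1, c s p.2 * (((g - g') (s, p.2)).1 * w s p.2)|
          ≤ (w p.1 p.2)⁻¹ * ((C * ‖g - g'‖) * (w p.1 p.2 / L)) :=
            mul_le_mul_of_nonneg_left h1 hwi.le
        _ = C * ‖g - g'‖ / L := by
            rw [← mul_assoc, mul_div_assoc', mul_comm (w p.1 p.2)⁻¹, mul_assoc,
              inv_mul_cancel₀ (hwpos _ _).ne', mul_one]
        _ ≤ 1 / 2 * dist g g' := by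
            rw [hdist, div_le_iff₀ hL0]
            nlinarith [norm_nonneg (g - g'), mul_le_mul_of_nonneg_right hCL (norm_nonneg (g - g'))]
  have hK : ContractingWith (1 / 2 : ℝ≥0) Φ := by
    refine ⟨by norm_num, LipschitzWith.of_dist_le_mul fun g g' => ?_⟩
    simpa using hLip g g'
  -- the fixed point and the invariant closed set of pairs vanishing on `Z`
  set g₀ := ContractingWith.fixedPoint Φ hK with hg₀
  have hfix : Φ g₀ = g₀ := ContractingWith.fixedPoint_isFixedPt hK
  set S : Set (ℝ × ℝ →ᵇ ℝ × ℝ) := {g | ∀ p ∈ Z, g p = 0} with hS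
  have hSclosed : IsClosed S := by
    have : S = ⋂ p ∈ Z, {g : ℝ × ℝ →ᵇ ℝ × ℝ | g p = 0} := by
      ext g; simp [hS]
    rw [this]
    exact isClosed_biInter fun p _ =>
      isClosed_eq (continuous_eval_const p) continuous_const
  have hSmaps : MapsTo Φ S S := by
    intro g hg p hp
    rw [hΦapply, hT]
    have hI1 : ∫ s in p.2..p.1, (g (p.1, s)).2 * w p.1 s = 0 := by
      rw [← intervalIntegral.integral_zero (a := p.2) (b := p.1) (μ := volume)]
      refine integral_congr fun s hs => ?_
      simp [hg _ (hZ1 p hp s hs)]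
    have hI2 : ∫ s in p.2..p.1, c s p.2 * ((g (s, p.2)).1 * w s p.2) = 0 := by
      rw [← intervalIntegral.integral_zero (a := p.2) (b := p.1) (μ := volume)]
      refine integral_congr fun s hs => ?_
      simp [hg _ (hZ2 p hp s hs)]
    simp [hI1, hI2, hZA p hp, hZA' p hp]
  have hg₀S : g₀ ∈ S := by
    have hiter : ∀ n : ℕ, Φ^[n] 0 ∈ S := by
      intro n
      induction n with
      | zero => intro p _; rfl
      | succ n ih => rw [Function.iterate_succ_apply']; exact hSmaps ih
    exact hSclosed.mem_of_tendsto (hK.tendsto_iterate_fixedPoint 0)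
      (Eventually.of_forall hiter)
  -- unweighting
  refine ⟨fun a b => (g₀ (a, b)).1 * w a b, fun a b => (g₀ (a, b)).2 * w a b, ?_, ?_, ?_, ?_, ?_⟩
  · exact (continuous_fst.comp g₀.continuous).mul hwcont
  · exact (continuous_snd.comp g₀.continuous).mul hwcont
  · intro a b
    have h := congrArg (fun g : ℝ × ℝ →ᵇ ℝ × ℝ => (g (a, b)).1) hfix
    simp only [hΦapply, hT] at h
    dsimp only
    rw [← h, mul_comm _ (w a b), ← mul_assoc, mul_inv_cancel₀ (hwpos a b).ne', one_mul]
  · intro a b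
    have h := congrArg (fun g : ℝ × ℝ →ᵇ ℝ × ℝ => (g (a, b)).2) hfix
    simp only [hΦapply, hT] at h
    dsimp only
    rw [← h, mul_comm _ (w a b), ← mul_assoc, mul_inv_cancel₀ (hwpos a b).ne', one_mul]
  · intro p hp
    have := hg₀S p hp
    simp [this]

end Summit.FinalStateConjecture.FinalStateConjecture.Theorems.Blindness

end
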